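import Literature.NumberTheory.EllipticCurves.BSDSelmerParityDokchitserTowerProofs
import Literature.NumberTheory.EllipticCurves.ZpCorankCyclotomicPrimePow
import HarnessLib

/-!
# bsd.S19, step (4) over the Heegner field: `m_ρ = p^n · a` and the parity of the faithful multiplicity
(third decomposition of `Literature.NumberTheory.EllipticCurves.dokchitser_selmerCorank_baseChange_mod_two_eq`)

Sequel to `BSDSelmerParityDokchitserTowerProofs`. There the named fact
`dokchitser_selmerCorank_baseChange_mod_two_eq` (T. Dokchitser, V. Dokchitser, Ann. of Math. 172
(2010), §4.6, proof of Thm. 4.19 (= Thm. 1.4) for `E/M₀`: `rk_p(E/M₀)` is odd for `E/ℚ` elliptic,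
`p` odd, `M₀` imaginary quadratic with all bad primes split) was reduced to the two displayed
statements of p. 27 over the layers `M_n` of the anticyclotomic `ℤ_p`-extension of `M₀`, with
`X n = zpCorank (Sel_{p^∞}(E/M_n)) p` (the tree's `WeierstrassCurve.selmerGroupOver W p
(κ.layerSubgroup n)`): `h417` — "`rk_p(E/M_n) + m_ρ` is even" where
`(p - 1) m_ρ = rk_p(E/M_{n+1}) - rk_p(E/M_n)` — and `hCV` — "`m_ρ = p^n` for `n` large".

The printed sentence behind `m_ρ = p^n` (p. 27) is: "So `X` contains exactly one copy of the unique
`(p-1)p^n`-dimensional `ℚ_p`-irreducible `p`-adic representation of `Gal(F/M₀)`. Its restriction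
to `H` is `ρ^{⊕p^n}`, and no other representation contributes to `ρ`, so `m_ρ = p^n` is odd."
This file PROVES the representation-theoretic half of that sentence for every elliptic curve over
every number field and every `ℤ_p`-extension —

* `WeierstrassCurve.exists_zpCorank_selmerGroupOver_layer_succ_eq_totient_mul`:
  **`rk_p(E/K_{n+1}) = rk_p(E/K_n) + (p - 1) p^n · a` for some `a ∈ ℕ`**, i.e. `m_ρ = p^n a`, `a`
  being the number of copies of the faithful `ℚ_p`-irreducible representation of
  `Gal(K_{n+1}/K) ≅ ℤ/p^{n+1}` in `X_p(E/K_{n+1})`. Mechanism: the conjugation action of a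
  topological generator `γ` of `Γ_K / Gal(K̄/K_∞) ≅ ℤ_p` on `Sel_{p^∞}(E/K_{n+1})` is an
  endomorphism `g` with `g^{p^{n+1}} = 1` (`γ^{p^{n+1}} ∈ Gal(K̄/K_{n+1})` acts trivially), the
  tree's `exists_zpCorank_eq_zpCorank_fixedSub_pow_add` (`ZpCorankCyclotomicPrimePow`:
  `corank A = corank A^{g^{p^n}} + p^n (p-1) a`, the kernel of the norm of `σ = g^{p^n}` being a
  `ℤ_p[ζ_{p^{n+1}}]`-module), and the relative Lemma 4.14
  (`zpCorank_selmerGroupOver_eq_relInvariants`, `SelmerRestrictionCorankRelative`) identifying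
  `corank Sel(E/K_{n+1})^{γ^{p^n}}` with `rk_p(E/K_n)` — exactly as for `m_ρ` in the Tower file,
  with `γ` in place of `γ^{p^n}`;
* hence `(p - 1) p^n ∣ rk_p(E/K_{n+1}) - rk_p(E/K_n)` and `rk_p(E/K_n) ≤ rk_p(E/K_{n+1})`
  (`totient_mul_dvd_zpCorank_selmerGroupOver_layer_succ_sub`, `zpCorank_selmerGroupOver_layer_mono`);

— and sharpens the assembly accordingly: **only the parity of the faithful multiplicity `a` at ONE
layer is needed**, together with the dihedral congruence at that layer
(`WeierstrassCurve.odd_selmerCorank_of_layer_congruence_of_odd_multiplicity`; over the Heegner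
field `odd_selmerCorank_baseChange_of_anticyclotomic_of_odd_multiplicity` and
`dokchitser_selmerCorank_baseChange_mod_two_eq_of_printed_of_odd_multiplicity`, whose second
hypothesis `hodd` — "for some `n`, `rk_p(E/M_{n+1}) = rk_p(E/M_n) + (p-1) p^n a` with `a` odd" — is
implied by `hCV` (`WeierstrassCurve.exists_odd_multiplicity_of_growth`), so that the Tower
reduction `dokchitser_selmerCorank_baseChange_mod_two_eq_of_printed''` factors through the present
one (not restated here: it would duplicate that theorem's statement). In the source `a = 1` for all
large `n` (Cornut–Vatsal 2007, Thm. 1.5 / 4.2, with Yuan–Zhang–Zhang and Tian–Zhang / Nekovář 2007,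
Thm. 3.2: "the `χ`-component of `X` has multiplicity 1" for a primitive character `χ` of
`Gal(M_{n+1}/M₀)`, all such `χ` being `Gal(ℚ̄_p/ℚ_p)`-conjugate).

Theorems only; no statement of the tree is changed and no named fact is introduced (D-0026). The two
remaining leaves of the printed proof are unchanged: the dihedral congruence (Prop. 4.17 with the
squares remark of p. 27) and the CM-point input (`a` odd, indeed `a = 1`, for `n` large).

## References

* [DokchitserDokchitserAnnals2010] T. Dokchitser, V. Dokchitser, *On the Birch–Swinnerton-Dyer
  quotients modulo squares*, Ann. of Math. 172 (2010), 567–596 = arXiv:math/0610290: Lemma 4.14,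
  Cor. 4.15, Prop. 4.17, §4.6 proof of Thm. 4.19 (pp. 24–27; arXiv numbering Lemma 47, Cor. 48,
  Prop. 50, Thm. 52).
* [CornutVatsal2007] C. Cornut, V. Vatsal, *Nontriviality of Rankin–Selberg `L`-functions and CM
  points*, in *L-functions and Galois representations* (Durham 2004), CUP 2007, Thm. 1.5, Thm. 4.2.
* [Nekovar2007] J. Nekovář, *The Euler system method for CM points on Shimura curves*, in the same
  volume, Thm. 3.2.
-/

noncomputable section

open scoped Classical AddSubgroup

open WeierstrassCurve Literature.NumberTheory.QuadraticFields

namespace Literature.NumberTheory.EllipticCurves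

/-! ### `m_ρ = p^n · a` -/

/-- **`rk_p(E/K_{n+1}) = rk_p(E/K_n) + (p - 1) p^n · a` for some `a ∈ ℕ`** — the multiplicity `m_ρ`
of the Tower file is `p^n a`, `a` being the number of copies of the faithful `ℚ_p`-irreducible
representation of `Gal(K_{n+1}/K) ≅ ℤ/p^{n+1}` (of dimension `φ(p^{n+1}) = (p-1)p^n`) in
`X_p(E/K_{n+1})` (Dokchitser–Dokchitser 2010, §4.6, p. 27: "`X` contains exactly one copy of the
unique `(p-1)p^n`-dimensional `ℚ_p`-irreducible `p`-adic representation of `Gal(F/M₀)`. Its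
restriction to `H` is `ρ^{⊕p^n}` [...] so `m_ρ = p^n`"; here the count `a` is left free). For any
elliptic curve `E` over any number field `K` and any `ℤ_p`-extension `κ` of `K`, in the tree's model
`Sel_{p^∞}(E/K_n) = E.selmerGroupOver p (κ.layerSubgroup n)`. Proof: a topological generator `γ` of
`Γ_K / Gal(K̄/K_∞)` acts on `T = Sel_{p^∞}(E/K_{n+1})` by conjugation as an endomorphism `g` with
`g^{p^{n+1}} = 1`; by `exists_zpCorank_eq_zpCorank_fixedSub_pow_add`,
`corank T = corank T^{g^{p^n}} + p^n (p-1) a`; and `T^{g^{p^n}} = Sel(E/K_{n+1})^{Gal(K_{n+1}/K_n)}`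
has corank `rk_p(E/K_n)` by the relative Lemma 4.14 (`zpCorank_selmerGroupOver_eq_relInvariants`).
[cite: DokchitserDokchitserAnnals2010, §4.6, proof of Thm. 4.19 (p. 27) with Lemma 4.14] -/
theorem _root_.WeierstrassCurve.exists_zpCorank_selmerGroupOver_layer_succ_eq_totient_mul
    {K : Type} [Field K] [NumberField K] (E : WeierstrassCurve K) [E.IsElliptic]
    (p : ℕ) [Fact p.Prime] (κ : ZpExtension K p) (n : ℕ) :
    ∃ a : ℕ, zpCorank (E.selmerGroupOver p (κ.layerSubgroup (n + 1))) p =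
      zpCorank (E.selmerGroupOver p (κ.layerSubgroup n)) p + (p - 1) * (p ^ n * a) := by
  set H := κ.layerSubgroup (n + 1) with hHdef
  set H' := κ.layerSubgroup n with hH'def
  have hle : H ≤ H' := κ.layerSubgroup_antitone n.le_succ
  haveI : (H.subgroupOf H').FiniteIndex := ⟨by
    show H.relIndex H' ≠ 0
    intro h0
    have := Subgroup.relIndex_mul_index hle
    rw [h0, zero_mul, κ.index_layerSubgroup] at this
    exact pow_ne_zero _ (Fact.out : p.Prime).ne_zero this.symm⟩
  obtain ⟨γ, hγ⟩ := κ.exists_isTopGenerator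
  -- relative Lemma 4.14: `X(n) = corank Sel(E/K_{n+1})^{H'}`
  have h414 := E.zpCorank_selmerGroupOver_eq_relInvariants p hle (κ.isOpen_layerSubgroup (n + 1))
    (κ.isOpen_layerSubgroup n)
  -- the conjugation `γ_*` on `T = Sel(E/K_{n+1})`
  set T := E.selmerGroupOver p H with hT
  haveI : Finite T[(p : ℤ)] := finite_torsionBy_selmerGroupOver E p H (κ.isOpen_layerSubgroup (n + 1))
  haveI : CompactSpace (Field.absoluteGaloisGroup K) := compactSpace_absoluteGaloisGroup K
  have hM : ∀ m : geomPrimaryTorsion E p, ∃ k : ℕ, p ^ k • m = 0 := fun m ↦ by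
    obtain ⟨k, hk⟩ := AddCommGroup.mem_primaryComponent.mp m.2
    exact ⟨k, Subtype.ext (by rw [AddSubmonoidClass.coe_nsmul, hk, ZeroMemClass.coe_zero])⟩
  have hTprim : ∀ t : T, ∃ m : ℕ, p ^ m • t = 0 := fun t ↦ by
    obtain ⟨m, hm⟩ := exists_pow_nsmul_eq_zero_subgroupH1 H
      (Subgroup.isClosed_of_isOpen H (κ.isOpen_layerSubgroup (n + 1))) hM (t : E.subgroupH1 p H)
    exact ⟨m, Subtype.ext (by rw [AddSubmonoidClass.coe_nsmul, hm, ZeroMemClass.coe_zero])⟩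
  have hstab : ∀ t ∈ T, E.conjH1 p H γ t ∈ T := fun t ht ↦
    E.map_conjH1_selmerGroupOver_le_holds p H γ ⟨t, ht, rfl⟩
  let gT : AddMonoid.End T := ((E.conjH1 p H γ).comp T.subtype).codRestrict T fun t ↦ hstab t t.2
  have hgT : ∀ t : T, ((gT t : T) : E.subgroupH1 p H) = E.conjH1 p H γ t := fun _ ↦ rfl
  have hgTpow : ∀ (m : ℕ) (t : T),
      (((gT ^ m) t : T) : E.subgroupH1 p H) = E.conjH1 p H (γ ^ m) t := by
    intro m
    induction m with
    | zero =>
      intro t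
      rw [pow_zero, pow_zero, AddMonoid.End.coe_one, id_eq, E.conjH1_one_holds p H,
        AddMonoidHom.id_apply]
    | succ m ih =>
      intro t
      rw [pow_succ, AddMonoid.End.coe_mul, Function.comp_apply, ih, pow_succ,
        E.conjH1_mul_holds p H, AddMonoidHom.comp_apply]
      rfl
  -- `γ^{p^{n+1}} ∈ H` acts trivially: `g^{p^{n+1}} = 1`
  have hg : gT ^ p ^ (n + 1) = 1 := by
    refine DFunLike.ext _ _ fun t ↦ ?_
    apply Subtype.ext
    rw [hgTpow, E.conjH1_of_mem_holds p H (κ.pow_mem_layerSubgroup hγ (n + 1)),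
      AddMonoidHom.id_apply, AddMonoid.End.coe_one, id_eq]
  -- the invariants of `g^{p^n} = (γ^{p^n})_*` in `T` are the `H'`-invariants
  set c := γ ^ p ^ n with hc
  have hKc : ∀ t : T, t ∈ fixedSub (gT ^ p ^ n) ↔
      (t : E.subgroupH1 p H) ∈ E.selmerGroupOverRelInvariants p H H' := fun t ↦ by
    rw [mem_fixedSub_iff, mem_selmerGroupOverRelInvariants_iff, Subtype.ext_iff, hgTpow, ← hc]
    symm
    refine ⟨fun h ↦ h.2 ⟨c, κ.pow_mem_layerSubgroup hγ n⟩, fun h ↦ ⟨t.2, fun g ↦ ?_⟩⟩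
    obtain ⟨h₁, j, hj⟩ := κ.exists_layerSubgroup_succ_mul_pow hγ n g
    rw [← hc] at hj
    have hk : ∀ j : ℕ, E.conjH1 p H (c ^ j) (t : E.subgroupH1 p H) = t := by
      intro j
      induction j with
      | zero => rw [pow_zero, E.conjH1_one_holds p H, AddMonoidHom.id_apply]
      | succ j ih => rw [pow_succ, E.conjH1_mul_holds p H, AddMonoidHom.comp_apply, h, ih]
    show E.conjH1 p H (g : Field.absoluteGaloisGroup K) (t : E.subgroupH1 p H) = t
    rw [hj, E.conjH1_mul_holds p H, AddMonoidHom.comp_apply, hk, E.conjH1_of_mem_holds p H h₁.2,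
      AddMonoidHom.id_apply]
  have hleT : E.selmerGroupOverRelInvariants p H H' ≤ T := fun y hy ↦
    ((E.mem_selmerGroupOverRelInvariants_iff p y).mp hy).1
  have eK : fixedSub (gT ^ p ^ n) ≃+ E.selmerGroupOverRelInvariants p H H' :=
    { toFun := fun t ↦ ⟨((t : T) : E.subgroupH1 p H), (hKc t).mp t.2⟩
      invFun := fun y ↦ ⟨⟨y, hleT y.2⟩, (hKc ⟨y, hleT y.2⟩).mpr y.2⟩
      left_inv := fun _ ↦ rfl
      right_inv := fun _ ↦ rfl
      map_add' := fun _ _ ↦ rfl }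
  obtain ⟨a, ha⟩ := exists_zpCorank_eq_zpCorank_fixedSub_pow_add hg hTprim
  refine ⟨a, ?_⟩
  rw [ha, zpCorank_congr eK p, ← h414]
  ring

/-- `m_ρ = p^n a` for the base change `E = W_{M₀}` of a curve over `ℚ` (the shape used in §4.6):
`rk_p(E/M_{n+1}) = rk_p(E/M_n) + (p - 1) p^n a`.
[cite: DokchitserDokchitserAnnals2010, §4.6, proof of Thm. 4.19 (p. 27) with Lemma 4.14] -/
theorem exists_zpCorank_selmerGroupOver_layer_succ_eq_totient_mul (W : WeierstrassCurve ℚ)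
    [W.IsElliptic] (p : ℕ) [Fact p.Prime] {K : Type} [Field K] [NumberField K]
    (κ : ZpExtension K p) (n : ℕ) :
    ∃ a : ℕ, zpCorank ((W.baseChange K).selmerGroupOver p (κ.layerSubgroup (n + 1))) p =
      zpCorank ((W.baseChange K).selmerGroupOver p (κ.layerSubgroup n)) p + (p - 1) * (p ^ n * a) :=
  (W.baseChange K).exists_zpCorank_selmerGroupOver_layer_succ_eq_totient_mul p κ n

/-- **`φ(p^{n+1}) = (p-1) p^n` divides `rk_p(E/K_{n+1}) - rk_p(E/K_n)`** (the non-trivial part of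
`X_p(E/K_{n+1})` as a `Gal(K_{n+1}/K_n)`-representation is a `ℚ_p(ζ_{p^{n+1}})`-vector space;
Dokchitser–Dokchitser 2010, §4.6, p. 27). [cite: DokchitserDokchitserAnnals2010, §4.6, proof of Thm. 4.19 (p. 27)] -/
theorem _root_.WeierstrassCurve.totient_mul_dvd_zpCorank_selmerGroupOver_layer_succ_sub
    {K : Type} [Field K] [NumberField K] (E : WeierstrassCurve K) [E.IsElliptic]
    (p : ℕ) [Fact p.Prime] (κ : ZpExtension K p) (n : ℕ) :
    (p - 1) * p ^ n ∣ zpCorank (E.selmerGroupOver p (κ.layerSubgroup (n + 1))) p -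
      zpCorank (E.selmerGroupOver p (κ.layerSubgroup n)) p := by
  obtain ⟨a, ha⟩ := E.exists_zpCorank_selmerGroupOver_layer_succ_eq_totient_mul p κ n
  exact ⟨a, by rw [ha, Nat.add_sub_cancel_left, mul_assoc]⟩

/-- **The `p^∞`-Selmer rank is non-decreasing along the layers**: `rk_p(E/K_n) ≤ rk_p(E/K_{n+1})`
("the Selmer rank is non-decreasing in extensions (e.g. by Lemma 4.14)", Dokchitser–Dokchitser
2010, Ex. 4.16, p. 25). [cite: DokchitserDokchitserAnnals2010, Lemma 4.14 and Ex. 4.16 (p. 25)] -/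
theorem _root_.WeierstrassCurve.zpCorank_selmerGroupOver_layer_mono
    {K : Type} [Field K] [NumberField K] (E : WeierstrassCurve K) [E.IsElliptic]
    (p : ℕ) [Fact p.Prime] (κ : ZpExtension K p) (n : ℕ) :
    zpCorank (E.selmerGroupOver p (κ.layerSubgroup n)) p ≤
      zpCorank (E.selmerGroupOver p (κ.layerSubgroup (n + 1))) p := by
  obtain ⟨a, ha⟩ := E.exists_zpCorank_selmerGroupOver_layer_succ_eq_totient_mul p κ n
  rw [ha]
  exact Nat.le_add_right _ _

/-- **The multiplicity `m_ρ` is `p^n a`**: whenever `rk_p(E/K_{n+1}) = rk_p(E/K_n) + (p-1) m`, in fact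
`m = p^n a` for some `a` (for `p ≠ 1`, which holds as `p` is prime).
[cite: DokchitserDokchitserAnnals2010, §4.6, proof of Thm. 4.19 (p. 27)] -/
theorem _root_.WeierstrassCurve.exists_eq_prime_pow_mul_of_zpCorank_selmerGroupOver_layer_succ_eq
    {K : Type} [Field K] [NumberField K] (E : WeierstrassCurve K) [E.IsElliptic]
    (p : ℕ) [Fact p.Prime] (κ : ZpExtension K p) {n m : ℕ}
    (hm : zpCorank (E.selmerGroupOver p (κ.layerSubgroup (n + 1))) p =
      zpCorank (E.selmerGroupOver p (κ.layerSubgroup n)) p + (p - 1) * m) :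
    ∃ a : ℕ, m = p ^ n * a := by
  obtain ⟨a, ha⟩ := E.exists_zpCorank_selmerGroupOver_layer_succ_eq_totient_mul p κ n
  have hp1 : 0 < p - 1 := Nat.sub_pos_of_lt (Fact.out : p.Prime).one_lt
  refine ⟨a, Nat.eq_of_mul_eq_mul_left hp1 ?_⟩
  omega

/-! ### The assembly: only the parity of the faithful multiplicity at one layer is needed -/

/-- **Skeleton, sharpened** (Dokchitser–Dokchitser 2010, §4.6, p. 27: "it suffices to show that
`m_ρ` is odd"; p. 26: "it suffices to prove the parity statement for `E/M_n` for some `n`"): for an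
elliptic curve `E` over a number field `K`, an odd prime `p` and a `ℤ_p`-extension `κ`, with
`X n = corank Sel_{p^∞}(E/K_n)`: if at SOME layer `n` the growth is `X (n+1) = X n + (p-1) p^n a`
with `a` ODD, and the dihedral congruence holds at that layer (`X n + m` even whenever
`X (n+1) = X n + (p-1) m`), then `rk_p(E/K)` is odd — `m_ρ = p^n a` is odd, hence `X n` is odd, hence
(Cor. 4.15 along `K ⊂ K_n`, `selmerCorank_mod_two_eq_zpCorank_selmerGroupOver_layer`) so is
`rk_p(E/K)`. [cite: DokchitserDokchitserAnnals2010, §4.6, proof of Thm. 4.19 (pp. 26–27)] -/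
theorem _root_.WeierstrassCurve.odd_selmerCorank_of_layer_congruence_of_odd_multiplicity
    {K : Type} [Field K] [NumberField K] (E : WeierstrassCurve K) [E.IsElliptic]
    (p : ℕ) [Fact p.Prime] (hp : p ≠ 2) (κ : ZpExtension K p) {n a : ℕ} (ha : Odd a)
    (hgrowth : zpCorank (E.selmerGroupOver p (κ.layerSubgroup (n + 1))) p =
      zpCorank (E.selmerGroupOver p (κ.layerSubgroup n)) p + (p - 1) * (p ^ n * a))
    (hcong : ∀ m : ℕ, zpCorank (E.selmerGroupOver p (κ.layerSubgroup (n + 1))) p =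
        zpCorank (E.selmerGroupOver p (κ.layerSubgroup n)) p + (p - 1) * m →
      Even (zpCorank (E.selmerGroupOver p (κ.layerSubgroup n)) p + m)) :
    Odd (E.selmerCorank p) := by
  have heven := hcong (p ^ n * a) hgrowth
  have hodd : Odd (p ^ n * a) := (((Fact.out : p.Prime).odd_of_ne_two hp).pow).mul ha
  have hlayer : Odd (zpCorank (E.selmerGroupOver p (κ.layerSubgroup n)) p) := by
    rcases heven with ⟨u, hu⟩
    rcases hodd with ⟨v, hv⟩
    exact ⟨u - v - 1, by omega⟩
  have htower := E.selmerCorank_mod_two_eq_zpCorank_selmerGroupOver_layer p hp κ n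
  rw [Nat.odd_iff] at hlayer ⊢
  rw [htower, hlayer]

/-- **Eventual growth `φ(p^{n+1})` per layer gives an odd faithful multiplicity** (`a = 1` at the
layer `n₀`): the hypothesis `hCV` of the Tower file implies the hypothesis `hodd` used below.
[cite: DokchitserDokchitserAnnals2010, §4.6, proof of Thm. 4.19 (p. 27)] -/
theorem _root_.WeierstrassCurve.exists_odd_multiplicity_of_growth
    {K : Type} [Field K] [NumberField K] (E : WeierstrassCurve K)
    (p : ℕ) [Fact p.Prime] (κ : ZpExtension K p)
    (hgrowth : ∃ n₀ : ℕ, ∀ n ≥ n₀, zpCorank (E.selmerGroupOver p (κ.layerSubgroup (n + 1))) p =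
      zpCorank (E.selmerGroupOver p (κ.layerSubgroup n)) p + (p - 1) * p ^ n) :
    ∃ n a : ℕ, Odd a ∧ zpCorank (E.selmerGroupOver p (κ.layerSubgroup (n + 1))) p =
      zpCorank (E.selmerGroupOver p (κ.layerSubgroup n)) p + (p - 1) * (p ^ n * a) := by
  obtain ⟨n₀, hn₀⟩ := hgrowth
  exact ⟨n₀, 1, odd_one, by rw [mul_one]; exact hn₀ n₀ le_rfl⟩

/-- **The `p`-parity statement for `E/M₀` from the dihedral congruence and an ODD faithful
multiplicity at one anticyclotomic layer** (Dokchitser–Dokchitser 2010, §4.6, proof of Thm. 4.19,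
pp. 26–27): for `E/ℚ` elliptic, `p` odd, `M₀ = K` imaginary quadratic in which all bad primes of `E`
split, and `κ` an anticyclotomic `ℤ_p`-extension of `M₀`, `rk_p(E/M₀)` is odd, granted `h417` — the
dihedral congruence "`rk_p(E/M_n) + m_ρ` even" (Prop. 4.17 with the squares remark of p. 27) — and
`hodd` — for some `n`, `rk_p(E/M_{n+1}) = rk_p(E/M_n) + (p-1) p^n a` with `a` odd (in the source
`a = 1` for all large `n`: Cornut–Vatsal with Tian–Zhang / Nekovář, "`m_ρ = p^n` is odd").
[cite: DokchitserDokchitserAnnals2010, §4.6, proof of Thm. 4.19 (pp. 26–27)] [cite: CornutVatsal2007, Thm. 1.5 and Thm. 4.2] [cite: Nekovar2007, Thm. 3.2] -/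
theorem odd_selmerCorank_baseChange_of_anticyclotomic_of_odd_multiplicity
    (h417 : ∀ (W : WeierstrassCurve ℚ) [W.IsElliptic] (p : ℕ) [Fact p.Prime], p ≠ 2 →
      ∀ (K : Type) [Field K] [NumberField K], IsImaginaryQuadratic K →
        SatisfiesHeegnerHypothesis (W.conductorNorm ℤ) K →
          ∀ (κ : ZpExtension K p), κ.IsAnticyclotomic → ∀ (n mρ : ℕ),
            zpCorank ((W.baseChange K).selmerGroupOver p (κ.layerSubgroup (n + 1))) p =
                zpCorank ((W.baseChange K).selmerGroupOver p (κ.layerSubgroup n)) p + (p - 1) * mρ →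
              Even (zpCorank ((W.baseChange K).selmerGroupOver p (κ.layerSubgroup n)) p + mρ))
    (hodd : ∀ (W : WeierstrassCurve ℚ) [W.IsElliptic] (p : ℕ) [Fact p.Prime], p ≠ 2 →
      ∀ (K : Type) [Field K] [NumberField K], IsImaginaryQuadratic K →
        SatisfiesHeegnerHypothesis (W.conductorNorm ℤ) K →
          ∀ (κ : ZpExtension K p), κ.IsAnticyclotomic → ∃ n a : ℕ, Odd a ∧
            zpCorank ((W.baseChange K).selmerGroupOver p (κ.layerSubgroup (n + 1))) p =
              zpCorank ((W.baseChange K).selmerGroupOver p (κ.layerSubgroup n)) p +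
                (p - 1) * (p ^ n * a))
    (W : WeierstrassCurve ℚ) [W.IsElliptic] (p : ℕ) [Fact p.Prime] (hp : p ≠ 2)
    (K : Type) [Field K] [NumberField K] (hK : IsImaginaryQuadratic K)
    (hH : SatisfiesHeegnerHypothesis (W.conductorNorm ℤ) K)
    (κ : ZpExtension K p) (hκ : κ.IsAnticyclotomic) :
    Odd ((W.baseChange K).selmerCorank p) := by
  obtain ⟨n, a, ha, hgrowth⟩ := hodd W p hp K hK hH κ hκ
  exact (W.baseChange K).odd_selmerCorank_of_layer_congruence_of_odd_multiplicity p hp κ ha hgrowth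
    (h417 W p hp K hK hH κ hκ n)

/-- **Step (4) of the proof of Thm. 4.19 (= Thm. 1.4) from the dihedral congruence and an odd
faithful multiplicity** — the target fact `dokchitser_selmerCorank_baseChange_mod_two_eq` from `h417`
and `hodd` only (the anticyclotomic `ℤ_p`-extension of `M₀` exists by the tree theorem
`ZpExtension.exists_isAnticyclotomic_holds`). Compared with
`dokchitser_selmerCorank_baseChange_mod_two_eq_of_printed''` (Tower file) the CM-point input is
weakened from "`m_ρ = p^n` for all large `n`" to "`m_ρ = p^n a` with `a` odd for some `n`"; that
reduction is recovered from this one by feeding `hodd` with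
`WeierstrassCurve.exists_odd_multiplicity_of_growth` applied to `hCV`.
[cite: DokchitserDokchitserAnnals2010, §4.6, proof of Thm. 4.19 (= Thm. 1.4), pp. 26–27] -/
theorem dokchitser_selmerCorank_baseChange_mod_two_eq_of_printed_of_odd_multiplicity
    (h417 : ∀ (W : WeierstrassCurve ℚ) [W.IsElliptic] (p : ℕ) [Fact p.Prime], p ≠ 2 →
      ∀ (K : Type) [Field K] [NumberField K], IsImaginaryQuadratic K →
        SatisfiesHeegnerHypothesis (W.conductorNorm ℤ) K →
          ∀ (κ : ZpExtension K p), κ.IsAnticyclotomic → ∀ (n mρ : ℕ),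
            zpCorank ((W.baseChange K).selmerGroupOver p (κ.layerSubgroup (n + 1))) p =
                zpCorank ((W.baseChange K).selmerGroupOver p (κ.layerSubgroup n)) p + (p - 1) * mρ →
              Even (zpCorank ((W.baseChange K).selmerGroupOver p (κ.layerSubgroup n)) p + mρ))
    (hodd : ∀ (W : WeierstrassCurve ℚ) [W.IsElliptic] (p : ℕ) [Fact p.Prime], p ≠ 2 →
      ∀ (K : Type) [Field K] [NumberField K], IsImaginaryQuadratic K →
        SatisfiesHeegnerHypothesis (W.conductorNorm ℤ) K →
          ∀ (κ : ZpExtension K p), κ.IsAnticyclotomic → ∃ n a : ℕ, Odd a ∧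
            zpCorank ((W.baseChange K).selmerGroupOver p (κ.layerSubgroup (n + 1))) p =
              zpCorank ((W.baseChange K).selmerGroupOver p (κ.layerSubgroup n)) p +
                (p - 1) * (p ^ n * a)) :
    dokchitser_selmerCorank_baseChange_mod_two_eq := by
  intro W _ p _ hp K _ _ hK hH
  haveI : NumberField.IsTotallyComplex K := hK.2
  have hanti : ZpExtension.exists_isAnticyclotomic (K := K) (p := p) :=
    ZpExtension.exists_isAnticyclotomic_holds
  obtain ⟨κ, hκ⟩ := hanti hK.1 NumberField.IsTotallyComplex.isComplex
  exact Nat.odd_iff.mp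
    (odd_selmerCorank_baseChange_of_anticyclotomic_of_odd_multiplicity h417 hodd W p hp K hK hH κ hκ)

end Literature.NumberTheory.EllipticCurves
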